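import Summits.QuantumFields.YangMills.Theorems.BalabanUVNodesN21ThresholdMixtureCommonBox

/-!
# YM-DAG node N21 (= NE7c) — THE THRESHOLD MIXTURE, PART 5a: the common box on the HALF-OPEN cells, RESCALING between the two runs' boxes,
# and the clamp letters — the tools for the two-threshold face (coupling-dependent thresholds) in print's currency

Track A of `YM-PLAN.md` (cell `pub-ymgap`, HUMAN RULING D-0062), node **N21**; R141 (C) fan-out seat `pub-ymgap-dag-n21-e` (s3 = ALTERNATIVE
CURRENCY), generation 3, file 11a.  Companions: 10a `…N21ThresholdMixtureCommonBox` (p477986: `siblingSuppression_of_sharpCommonBox` on the CLOSED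
box), file 3 `…N21ProfiledThresholdSync` (p459145: the clamp re-reading `w^A = max((1−κ)θ^A, min(θ^A, u^A))`, `w^B = max((1−κ)θ^A, min(θ^A,
(θ^A∕θ^B)u^B))`), file 8 `…N21AtSpineCarriersMixtureTwoThresholds` (p470362: each run averaged over ITS OWN box).  Kernel bookkeeping + one change of
variables: 0 `def`, 0 `sorry`, standard axioms.  COUNT-NEUTRAL; `--supports` the K3′ item `SpineGivenEndpointR12` as a helper.

WHAT THIS FILE SUPPLIES (for file 11b's two-threshold common-box knit).  §1 `siblingSuppression_of_sharpCommonBox_Ioc`: file 10a's constructor with the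
sharp class-relative sibling bound asked only on the HALF-OPEN common box `∏_c ((1 − κ_{aC c})θC_c, θC_c]` (the faces `S_c = (1 − κ)θC_c` are
Lebesgue-null, `ae_mem_Ioc_box_pi`) — strictly weaker hypothesis; on the half-open cells the clamp letters of §3 are EXACT.  §2 RESCALING: the
coordinatewise map `s ↦ ((θ^B_i∕θ^A_i)·s_i)_i` pushes run A's box `⊗_i Leb|[(1−κ_i)θ^A_i, θ^A_i]` to `(∏_i θ^A_i∕θ^B_i) •` run B's box
(`pi_map_rescale_box`), so run B's OWN-box normalised average (file 8's `hB`) equals the run-A-box normalised average of its sharp weights read at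
the rescaled thresholds (`average_rescale_box`) — «common MULTIPLIERS `λ_c ∈ [1 − κ, 1]`, each run at its own thresholds `λθ^A`, `λθ^B`».  §3 CLAMP
LETTERS on the half-open cell `(1 − κ)θ < s ≤ θ`: `1[clamp(u) < s] = 1[u < s]` (`smallInd_clamp_eq`) and `1[clamp_A((θ^A∕θ^B)u) < s] = 1[u < (θ^B∕θ^A)s]`
(`smallInd_clamp_rescaled_eq`) — the sharp factors of file 3's clamped variables ARE the runs' own sharp factors at common multipliers; product
forms `prod_fac_clamp_eq`, `prod_fac_clamp_rescaled_eq`, `prod_ite_fac_clamp_eq`, `prod_ite_fac_clamp_rescaled_eq`.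

HONEST FRAMING.  Measure theory and bookkeeping only; nothing of Bałaban's asserted; NE7c NOT PRINTED ∕ NOT proved; N21 NOT discharged;
count-neutral; one finite four-torus programme at fixed `ε`; NOT continuum ∕ ℝ⁴ ∕ OS ∕ mass gap ∕ Clay.

CITATION HEADER (lean-in-tree rule 2026-08-18).  BY NAME: file 10a `ae_mem_box_pi`, `integrable_Xs_box`, `integrable_Sbs_box`,
`sum_average_le_sum_of_forall_proj`; file 9 `sibW_eq_sharpMixture`; `T4LipschitzCutoff.SiblingSuppression` ∕ `linProfile`; `T4LipschitzLedger.Pol` ∕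
`sibW`; `T4IndicatorShell.smallInd`; Mathlib `Measure.ae_eval_ne`, `ae_all_iff`, `Real.volume_preimage_mul_left`, `Measure.restrict_apply'`,
`Measure.map_apply`, `Measure.pi_pi`, `ext_of_generate_finite`, `generateFrom_pi`, `isPiSystem_pi`, `integral_map`, `integral_smul_measure`.
Context only (SHAPE): [Balaban1988Convergent] (2.17)∕(2.18) p. 257; [Balaban1989LargeFieldI] p. 193.

WHAT IS PROVED ([folklore]).  §1 `ae_mem_Ioc_box_pi`, **`siblingSuppression_of_sharpCommonBox_Ioc`** · §2 `preimage_smul_univ_pi`,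
`volume_restrict_Icc_preimage_mul_left`, `pi_map_rescale_box`, `integral_comp_rescale_box`, **`average_rescale_box`** · §3 `smallInd_clamp_eq`,
`smallInd_clamp_rescaled_eq`, `prod_fac_clamp_eq`, `prod_fac_clamp_rescaled_eq`, `prod_ite_fac_clamp_eq`, `prod_ite_fac_clamp_rescaled_eq`.
-/

set_option autoImplicit false

noncomputable section

open MeasureTheory Set
open scoped BigOperators ENNReal

namespace Summit.QuantumFields.YangMills.Theorems.N21ThresholdMixtureCommonBoxRescale

open Literature.MathematicalPhysics.QuantumFieldTheory.Balaban1983to89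
open Literature.MathematicalPhysics.QuantumFieldTheory.Balaban1983to89.T4LipschitzCutoff
open Literature.MathematicalPhysics.QuantumFieldTheory.Balaban1983to89.T4IndicatorShell
open Literature.MathematicalPhysics.QuantumFieldTheory.Balaban1983to89.T4LipschitzLedger
open N21ThresholdMixtureSibling (sibW_eq_sharpMixture)
open N21ThresholdMixtureCommonBox (ae_mem_box_pi integrable_Xs_box integrable_Sbs_box sum_average_le_sum_of_forall_proj)

/-! ## §1 The common box on the half-open cells -/

section HalfOpen

/-- under a product of interval-restricted Lebesgue measures, almost every vector lies in the product of the HALF-OPEN cells `(lo_c, hi_c]` (the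
faces `S_c = lo_c` are null: `Measure.ae_eval_ne`). [folklore] -/
theorem ae_mem_Ioc_box_pi {n : ℕ} (lo hi : Fin n → ℝ) :
    ∀ᵐ S ∂(Measure.pi fun c : Fin n => (volume : Measure ℝ).restrict (Icc (lo c) (hi c))), ∀ c, S c ∈ Ioc (lo c) (hi c) := by
  have hne : ∀ c : Fin n, ∀ᵐ S ∂(Measure.pi fun c : Fin n => (volume : Measure ℝ).restrict (Icc (lo c) (hi c))), S c ≠ lo c :=
    fun c => Measure.ae_eval_ne (fun c : Fin n => (volume : Measure ℝ).restrict (Icc (lo c) (hi c))) c (lo c)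
  filter_upwards [ae_mem_box_pi lo hi, ae_all_iff.2 hne] with S hS hS'
  exact fun c => ⟨lt_of_le_of_ne (hS c).1 (fun h => hS' c h.symm), (hS c).2⟩

variable {ι : Type*} {Ω : ℕ → ι → Type*} [∀ K τ, MeasurableSpace (Ω K τ)]
  {l₀ : ℝ} {T : ℕ → Finset ι} {X : ℕ → ℝ → ι → ℝ} {κ : ℕ → ℝ} {N : ℕ} {n : ℕ → ℕ}
  {μ : (K : ℕ) → (τ : ι) → Measure (Ω K τ)} [∀ K τ, SFinite (μ K τ)] {m : ℕ → ι → ℕ} {slot : ℕ → ι → ℕ → Σ _ : ℕ, ℕ}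
  {pol : ℕ → ι → ℕ → Pol} {θ : ℕ → ι → ℕ → ℝ} {uX : (K : ℕ) → (τ : ι) → ℕ → Ω K τ → ℝ}
  {RX : (K : ℕ) → ℝ → (τ : ι) → Ω K τ → ℝ} {ρ Ssup : ℕ → ℝ}
  {nC : ℕ → ℕ} {aC : ℕ → ℕ → ℕ} {θC : ℕ → ℕ → ℝ} {e : (K : ℕ) → (τ : ι) → Fin (m K τ) → Fin (nC K)}

/-- **FILE 10a's CONSTRUCTOR ON THE HALF-OPEN COMMON BOX.**  Exactly `…N21ThresholdMixtureCommonBox.siblingSuppression_of_sharpCommonBox`, but the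
SHARP class-relative sibling bound `hsharp` is asked only for threshold assignments `S` with `S c ∈ Ioc ((1 − κ_{aC K c})·θC K c) (θC K c)` for every
occurrence `c` — the half-open cells, on which the clamp letters of §3 are exact; the closed faces are null (`ae_mem_Ioc_box_pi`).  Same conclusion:
`SiblingSuppression l₀ T X N n (sibW (fun a => linProfile (κ a)) κ μ m slot pol θ uX RX ρ) Ssup`. [folklore] -/
theorem siblingSuppression_of_sharpCommonBox_Ioc
    (Xs : (K : ℕ) → ℝ → (τ : ι) → (Fin (m K τ) → ℝ) → ℝ) (Sbs : (Σ _ : ℕ, ℕ) → (K : ℕ) → ℝ → (τ : ι) → (Fin (m K τ) → ℝ) → ℝ)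
    (hκ : ∀ a, 0 < κ a) (thr_pos : ∀ K, ∀ τ ∈ T K, ∀ i < m K τ, 0 < θ K τ i)
    (meas : ∀ K, ∀ τ ∈ T K, ∀ i < m K τ, Measurable (uX K τ i))
    (rem_int : ∀ K t, |t| ≤ l₀ → ∀ τ ∈ T K, Integrable (RX K t τ) (μ K τ))
    (hXs : ∀ K t, |t| ≤ l₀ → ∀ τ ∈ T K, ∀ s : Fin (m K τ) → ℝ,
      Xs K t τ s = ∫ v, (∏ i : Fin (m K τ), (pol K τ i).fac (smallInd (uX K τ i v) (s i))) * RX K t τ v ∂(μ K τ))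
    (hX : ∀ K t, |t| ≤ l₀ → ∀ τ ∈ T K, X K t τ =
      (∏ i : Fin (m K τ), (κ (slot K τ i).1 * θ K τ i))⁻¹ *
        ∫ s, Xs K t τ s ∂(Measure.pi fun i : Fin (m K τ) =>
          volume.restrict (Icc ((1 - κ (slot K τ i).1) * θ K τ i) (θ K τ i))))
    (hSbs : ∀ σ K t, |t| ≤ l₀ → ∀ τ ∈ T K, ∀ s : Fin (m K τ) → ℝ,
      Sbs σ K t τ s = ∑ i ∈ (Finset.range (m K τ)).filter (fun i => slot K τ i = σ),
          ∫ v, (pol K τ i).shell (uX K τ i v) (θ K τ i) (κ (slot K τ i).1) (ρ (K - (slot K τ i).1) * θ K τ i) *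
            (∏ j : Fin (m K τ), (if (j : ℕ) = i then (1 : ℝ) else (pol K τ j).fac (smallInd (uX K τ j v) (s j)))) *
              RX K t τ v ∂(μ K τ))
    (hθC : ∀ K c, 0 < θC K c) (he : ∀ K, ∀ τ ∈ T K, Function.Injective (e K τ))
    (he_age : ∀ K, ∀ τ ∈ T K, ∀ j : Fin (m K τ), (slot K τ j).1 = aC K (e K τ j))
    (he_thr : ∀ K, ∀ τ ∈ T K, ∀ j : Fin (m K τ), θ K τ j = θC K (e K τ j))
    (hsharp : ∀ σ ∈ (Finset.range (N + 1)).sigma (fun a => Finset.range (n a)), ∀ K t, |t| ≤ l₀ →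
      ∀ S : Fin (nC K) → ℝ, (∀ c : Fin (nC K), S c ∈ Ioc ((1 - κ (aC K c)) * θC K c) (θC K c)) →
        ∑ τ ∈ T K, Sbs σ K t τ (fun j => S (e K τ j)) ≤ Ssup σ.1 * ∑ τ ∈ T K, Xs K t τ (fun j => S (e K τ j))) :
    SiblingSuppression l₀ T X N n (sibW (fun a => linProfile (κ a)) κ μ m slot pol θ uX RX ρ) Ssup := by
  intro σ hσ K t ht
  set ν : Fin (nC K) → Measure ℝ := fun c => (volume : Measure ℝ).restrict (Icc ((1 - κ (aC K c)) * θC K c) (θC K c)) with hν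
  have hmass : ∀ c, (ν c univ).toReal = κ (aC K c) * θC K c := by
    intro c
    have hle : 0 ≤ θC K c - (1 - κ (aC K c)) * θC K c := by nlinarith [hκ (aC K c), hθC K c]
    simp only [hν, Measure.restrict_apply MeasurableSet.univ, Set.univ_inter, Real.volume_Icc]
    rw [ENNReal.toReal_ofReal hle]
    ring
  have hν0 : ∀ c, ν c univ ≠ 0 := by
    intro c h0
    have h := hmass c
    rw [h0, ENNReal.toReal_zero] at h
    exact (mul_pos (hκ (aC K c)) (hθC K c)).ne' h.symm
  have hbox : ∀ τ ∈ T K,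
      (Measure.pi fun i : Fin (m K τ) => (volume : Measure ℝ).restrict (Icc ((1 - κ (slot K τ i).1) * θ K τ i) (θ K τ i))) =
        Measure.pi fun j => ν (e K τ j) := by
    intro τ hτ
    congr 1
    funext j
    simp only [hν, he_age K τ hτ j, he_thr K τ hτ j]
  have hnorm : ∀ τ ∈ T K, (∏ i : Fin (m K τ), (κ (slot K τ i).1 * θ K τ i)) = ∏ j, (ν (e K τ j) univ).toReal := by
    intro τ hτ
    exact Finset.prod_congr rfl fun j _ => by rw [hmass, ← he_age K τ hτ j, ← he_thr K τ hτ j]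
  have hL : ∀ τ ∈ T K, sibW (fun a => linProfile (κ a)) κ μ m slot pol θ uX RX ρ σ K t τ =
      (∏ j, (ν (e K τ j) univ).toReal)⁻¹ * ∫ x, Sbs σ K t τ x ∂(Measure.pi fun j => ν (e K τ j)) := by
    intro τ hτ
    rw [sibW_eq_sharpMixture hκ K t τ (thr_pos K τ hτ) (meas K τ hτ) (rem_int K t ht τ hτ) σ, hnorm τ hτ, hbox τ hτ]
    congr 1
    exact integral_congr_ae (ae_of_all _ fun s => (hSbs σ K t ht τ hτ s).symm)
  have hR : ∀ τ ∈ T K, X K t τ = (∏ j, (ν (e K τ j) univ).toReal)⁻¹ * ∫ x, Xs K t τ x ∂(Measure.pi fun j => ν (e K τ j)) := by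
    intro τ hτ
    rw [hX K t ht τ hτ, hnorm τ hτ, hbox τ hτ]
  rw [Finset.sum_congr rfl hL, Finset.sum_congr rfl hR]
  have hg : ∀ τ ∈ T K, Integrable (Sbs σ K t τ) (Measure.pi fun j => ν (e K τ j)) := fun τ hτ =>
    integrable_Sbs_box Sbs (meas K τ hτ) (rem_int K t ht τ hτ) (hSbs σ K t ht τ hτ) _ _
  have hf : ∀ τ ∈ T K, Integrable (Xs K t τ) (Measure.pi fun j => ν (e K τ j)) := fun τ hτ =>
    integrable_Xs_box Xs (meas K τ hτ) (rem_int K t ht τ hτ) (hXs K t ht τ hτ) _ _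
  have hae : ∀ᵐ S ∂(Measure.pi ν),
      ∑ τ ∈ T K, Sbs σ K t τ (fun j => S (e K τ j)) ≤ Ssup σ.1 * ∑ τ ∈ T K, Xs K t τ (fun j => S (e K τ j)) := by
    filter_upwards [ae_mem_Ioc_box_pi (fun c : Fin (nC K) => (1 - κ (aC K c)) * θC K c) (fun c => θC K c)] with S hS
    exact hsharp σ hσ K t ht S hS
  exact sum_average_le_sum_of_forall_proj ν hν0 (T K) (T K) (e K) (he K) (he K) (fun τ => Sbs σ K t τ) (fun τ => Xs K t τ)
    (Ssup σ.1) hg hf hae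

end HalfOpen

/-! ## §2 Rescaling between the two runs' boxes -/

section Rescale

/-- the preimage of a rectangle under a coordinatewise rescaling is the rectangle of the preimages. [folklore] -/
theorem preimage_smul_univ_pi {n : ℕ} (c : Fin n → ℝ) (t : Fin n → Set ℝ) :
    (fun (s : Fin n → ℝ) (i : Fin n) => c i * s i) ⁻¹' Set.pi univ t = Set.pi univ fun i => (fun x : ℝ => c i * x) ⁻¹' t i := by
  ext s
  simp only [Set.mem_preimage, Set.mem_univ_pi]

/-- one coordinate: `Leb|[lo, hi] ((c·)⁻¹ t) = c⁻¹ · Leb|[c·lo, c·hi] (t)` for `c > 0` (`Real.volume_preimage_mul_left`). [folklore] -/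
theorem volume_restrict_Icc_preimage_mul_left {c : ℝ} (hc : 0 < c) (lo hi : ℝ) (t : Set ℝ) :
    (volume : Measure ℝ).restrict (Icc lo hi) ((fun x : ℝ => c * x) ⁻¹' t) =
      ENNReal.ofReal c⁻¹ * (volume : Measure ℝ).restrict (Icc (c * lo) (c * hi)) t := by
  have hIcc : Icc lo hi = (fun x : ℝ => c * x) ⁻¹' Icc (c * lo) (c * hi) := by
    ext x
    simp only [Set.mem_preimage, Set.mem_Icc]
    constructor
    · rintro ⟨h1, h2⟩
      exact ⟨mul_le_mul_of_nonneg_left h1 hc.le, mul_le_mul_of_nonneg_left h2 hc.le⟩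
    · rintro ⟨h1, h2⟩
      exact ⟨le_of_mul_le_mul_left h1 hc, le_of_mul_le_mul_left h2 hc⟩
  rw [Measure.restrict_apply' measurableSet_Icc, Measure.restrict_apply' measurableSet_Icc, hIcc, ← Set.preimage_inter,
    Real.volume_preimage_mul_left hc.ne', abs_of_pos (inv_pos.2 hc)]

/-- **RESCALING RUN A's BOX ONTO RUN B's.**  For positive `κ_i`, `θ^A_i`, `θ^B_i`, the coordinatewise map `s ↦ ((θ^B_i∕θ^A_i)·s_i)_i` pushes
`⊗_i Leb|[(1 − κ_i)θ^A_i, θ^A_i]` forward to `(∏_i θ^A_i∕θ^B_i) • ⊗_i Leb|[(1 − κ_i)θ^B_i, θ^B_i]` (rectangles + `ext_of_generate_finite`). [folklore] -/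
theorem pi_map_rescale_box {n : ℕ} (κ θA θB : Fin n → ℝ) (hA : ∀ i, 0 < θA i) (hB : ∀ i, 0 < θB i) :
    (Measure.pi fun i : Fin n => (volume : Measure ℝ).restrict (Icc ((1 - κ i) * θA i) (θA i))).map
        (fun (s : Fin n → ℝ) (i : Fin n) => θB i / θA i * s i) =
      (∏ i, ENNReal.ofReal (θA i / θB i)) • Measure.pi fun i : Fin n => (volume : Measure ℝ).restrict (Icc ((1 - κ i) * θB i) (θB i)) := by
  have hmeas : Measurable fun (s : Fin n → ℝ) (i : Fin n) => θB i / θA i * s i :=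
    measurable_pi_lambda _ fun i => measurable_const.mul (measurable_pi_apply i)
  have hc : ∀ i, 0 < θB i / θA i := fun i => div_pos (hB i) (hA i)
  have e1 : ∀ i, θB i / θA i * ((1 - κ i) * θA i) = (1 - κ i) * θB i := fun i => by
    rw [mul_comm (1 - κ i) (θA i), ← mul_assoc, div_mul_cancel₀ _ (hA i).ne', mul_comm]
  have e2 : ∀ i, θB i / θA i * θA i = θB i := fun i => div_mul_cancel₀ _ (hA i).ne'
  have e3 : ∀ i, (θB i / θA i)⁻¹ = θA i / θB i := fun i => inv_div _ _
  have key : ∀ t : Fin n → Set ℝ, (∀ i, MeasurableSet (t i)) →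
      ((Measure.pi fun i : Fin n => (volume : Measure ℝ).restrict (Icc ((1 - κ i) * θA i) (θA i))).map
          (fun (s : Fin n → ℝ) (i : Fin n) => θB i / θA i * s i)) (Set.pi univ t) =
        ((∏ i, ENNReal.ofReal (θA i / θB i)) •
          Measure.pi fun i : Fin n => (volume : Measure ℝ).restrict (Icc ((1 - κ i) * θB i) (θB i))) (Set.pi univ t) := by
    intro t ht
    rw [Measure.map_apply hmeas (MeasurableSet.univ_pi ht), preimage_smul_univ_pi, Measure.pi_pi, Measure.smul_apply, Measure.pi_pi,
      smul_eq_mul, ← Finset.prod_mul_distrib]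
    refine Finset.prod_congr rfl fun i _ => ?_
    rw [volume_restrict_Icc_preimage_mul_left (hc i), e1 i, e2 i, e3 i]
  refine ext_of_generate_finite _ generateFrom_pi.symm isPiSystem_pi ?_ ?_
  · rintro _ ⟨t, ht, rfl⟩
    exact key t fun i => ht i (Set.mem_univ i)
  · rw [← Set.pi_univ (univ : Set (Fin n))]
    exact key _ fun _ => MeasurableSet.univ

/-- integrating `f` at the rescaled thresholds over run A's box = `(∏_i θ^A_i∕θ^B_i) ×` the integral of `f` over run B's box. [folklore] -/
theorem integral_comp_rescale_box {n : ℕ} (κ θA θB : Fin n → ℝ) (hA : ∀ i, 0 < θA i) (hB : ∀ i, 0 < θB i) {f : (Fin n → ℝ) → ℝ}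
    (hf : AEStronglyMeasurable f (Measure.pi fun i : Fin n => (volume : Measure ℝ).restrict (Icc ((1 - κ i) * θB i) (θB i)))) :
    ∫ s, f (fun i => θB i / θA i * s i) ∂(Measure.pi fun i : Fin n => (volume : Measure ℝ).restrict (Icc ((1 - κ i) * θA i) (θA i))) =
      (∏ i, (θA i / θB i)) * ∫ x, f x ∂(Measure.pi fun i : Fin n => (volume : Measure ℝ).restrict (Icc ((1 - κ i) * θB i) (θB i))) := by
  have hmeas : Measurable fun (s : Fin n → ℝ) (i : Fin n) => θB i / θA i * s i :=
    measurable_pi_lambda _ fun i => measurable_const.mul (measurable_pi_apply i)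
  have hf' : AEStronglyMeasurable f ((Measure.pi fun i : Fin n => (volume : Measure ℝ).restrict (Icc ((1 - κ i) * θA i) (θA i))).map
      fun (s : Fin n → ℝ) (i : Fin n) => θB i / θA i * s i) := by
    rw [pi_map_rescale_box κ θA θB hA hB]
    exact hf.smul_measure _
  rw [← integral_map hmeas.aemeasurable hf', pi_map_rescale_box κ θA θB hA hB, integral_smul_measure, ENNReal.toReal_prod, smul_eq_mul]
  congr 1
  exact Finset.prod_congr rfl fun i _ => ENNReal.toReal_ofReal (div_pos (hA i) (hB i)).le

/-- **COMMON MULTIPLIERS, EACH RUN AT ITS OWN THRESHOLDS.**  Run B's OWN-box normalised average of `f` (file 8's `hB` carrier pinning) EQUALS the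
run-A-box normalised average of `f` read at the rescaled thresholds `(θ^B_i∕θ^A_i)·s_i` — i.e. at run B's thresholds times the COMMON multipliers
`λ_i = s_i∕θ^A_i ∈ [1 − κ_i, 1]`. [folklore] -/
theorem average_rescale_box {n : ℕ} (κ θA θB : Fin n → ℝ) (hκ : ∀ i, 0 < κ i) (hA : ∀ i, 0 < θA i) (hB : ∀ i, 0 < θB i)
    {f : (Fin n → ℝ) → ℝ}
    (hf : AEStronglyMeasurable f (Measure.pi fun i : Fin n => (volume : Measure ℝ).restrict (Icc ((1 - κ i) * θB i) (θB i)))) :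
    (∏ i, (κ i * θA i))⁻¹ *
        ∫ s, f (fun i => θB i / θA i * s i) ∂(Measure.pi fun i : Fin n => (volume : Measure ℝ).restrict (Icc ((1 - κ i) * θA i) (θA i))) =
      (∏ i, (κ i * θB i))⁻¹ * ∫ x, f x ∂(Measure.pi fun i : Fin n => (volume : Measure ℝ).restrict (Icc ((1 - κ i) * θB i) (θB i))) := by
  rw [integral_comp_rescale_box κ θA θB hA hB hf, ← mul_assoc]
  congr 1
  rw [← Finset.prod_inv_distrib, ← Finset.prod_mul_distrib, ← Finset.prod_inv_distrib]
  refine Finset.prod_congr rfl fun i _ => ?_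
  have hκi := (hκ i).ne'
  have hAi := (hA i).ne'
  have hBi := (hB i).ne'
  field_simp

end Rescale

/-! ## §3 The clamp letters on the half-open cell -/

section Clamp

/-- **ON THE HALF-OPEN CELL THE CLAMP IS INVISIBLE TO THE SHARP INDICATOR**: for `(1 − κ)θ < s ≤ θ`, `1[max((1−κ)θ, min(θ, u)) < s] = 1[u < s]`.
[folklore] -/
theorem smallInd_clamp_eq {κ θ s : ℝ} (hlo : (1 - κ) * θ < s) (hhi : s ≤ θ) (u : ℝ) :
    smallInd (max ((1 - κ) * θ) (min θ u)) s = smallInd u s := by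
  unfold smallInd
  by_cases hu : u < s
  · rw [if_pos hu, if_pos (max_lt hlo ((min_le_right _ _).trans_lt hu))]
  · rw [if_neg hu, if_neg (not_lt.2 ((le_min hhi (not_lt.1 hu)).trans (le_max_right _ _)))]

/-- … and the rescaled clamp of file 3 reads run B SHARP at its own threshold times the common multiplier:
`1[max((1−κ)θ^A, min(θ^A, (θ^A∕θ^B)u)) < s] = 1[u < (θ^B∕θ^A)s]` for `(1 − κ)θ^A < s ≤ θ^A`. [folklore] -/
theorem smallInd_clamp_rescaled_eq {κ θA θB s : ℝ} (hA : 0 < θA) (hB : 0 < θB) (hlo : (1 - κ) * θA < s) (hhi : s ≤ θA) (u : ℝ) :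
    smallInd (max ((1 - κ) * θA) (min θA (θA / θB * u))) s = smallInd u (θB / θA * s) := by
  rw [smallInd_clamp_eq hlo hhi]
  unfold smallInd
  have hiff : θA / θB * u < s ↔ u < θB / θA * s := by
    rw [div_mul_eq_mul_div, div_lt_iff₀ hB, div_mul_eq_mul_div, lt_div_iff₀ hA, mul_comm θA u, mul_comm s θB]
  by_cases h : θA / θB * u < s
  · rw [if_pos h, if_pos (hiff.1 h)]
  · rw [if_neg h, if_neg (fun h' => h (hiff.2 h'))]

/-- product form over a term's factors (run A): on the half-open box the clamped sharp product IS run A's sharp product. [folklore] -/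
theorem prod_fac_clamp_eq {m : ℕ} (pol : Fin m → Pol) (κ θ u s : Fin m → ℝ) (hs : ∀ j, s j ∈ Ioc ((1 - κ j) * θ j) (θ j)) :
    ∏ j, (pol j).fac (smallInd (max ((1 - κ j) * θ j) (min (θ j) (u j))) (s j)) = ∏ j, (pol j).fac (smallInd (u j) (s j)) :=
  Finset.prod_congr rfl fun j _ => by rw [smallInd_clamp_eq (hs j).1 (hs j).2]

/-- product form (run B): on the half-open box the clamped-rescaled sharp product IS run B's sharp product at the rescaled thresholds. [folklore] -/
theorem prod_fac_clamp_rescaled_eq {m : ℕ} (pol : Fin m → Pol) (κ θA θB u s : Fin m → ℝ) (hA : ∀ j, 0 < θA j) (hB : ∀ j, 0 < θB j)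
    (hs : ∀ j, s j ∈ Ioc ((1 - κ j) * θA j) (θA j)) :
    ∏ j, (pol j).fac (smallInd (max ((1 - κ j) * θA j) (min (θA j) (θA j / θB j * u j))) (s j)) =
      ∏ j, (pol j).fac (smallInd (u j) (θB j / θA j * s j)) :=
  Finset.prod_congr rfl fun j _ => by rw [smallInd_clamp_rescaled_eq (hA j) (hB j) (hs j).1 (hs j).2]

/-- sibling form (run A): the same with factor `i` replaced by `1`. [folklore] -/
theorem prod_ite_fac_clamp_eq {m : ℕ} (pol : Fin m → Pol) (κ θ u s : Fin m → ℝ) (hs : ∀ j, s j ∈ Ioc ((1 - κ j) * θ j) (θ j)) (i : ℕ) :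
    ∏ j : Fin m, (if (j : ℕ) = i then (1 : ℝ) else (pol j).fac (smallInd (max ((1 - κ j) * θ j) (min (θ j) (u j))) (s j))) =
      ∏ j : Fin m, (if (j : ℕ) = i then (1 : ℝ) else (pol j).fac (smallInd (u j) (s j))) :=
  Finset.prod_congr rfl fun j _ => by
    by_cases hj : (j : ℕ) = i
    · simp only [hj, if_true]
    · simp only [hj, if_false, smallInd_clamp_eq (hs j).1 (hs j).2]

/-- sibling form (run B). [folklore] -/
theorem prod_ite_fac_clamp_rescaled_eq {m : ℕ} (pol : Fin m → Pol) (κ θA θB u s : Fin m → ℝ) (hA : ∀ j, 0 < θA j) (hB : ∀ j, 0 < θB j)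
    (hs : ∀ j, s j ∈ Ioc ((1 - κ j) * θA j) (θA j)) (i : ℕ) :
    ∏ j : Fin m, (if (j : ℕ) = i then (1 : ℝ) else (pol j).fac (smallInd (max ((1 - κ j) * θA j) (min (θA j) (θA j / θB j * u j))) (s j))) =
      ∏ j : Fin m, (if (j : ℕ) = i then (1 : ℝ) else (pol j).fac (smallInd (u j) (θB j / θA j * s j))) :=
  Finset.prod_congr rfl fun j _ => by
    by_cases hj : (j : ℕ) = i
    · simp only [hj, if_true]
    · simp only [hj, if_false, smallInd_clamp_rescaled_eq (hA j) (hB j) (hs j).1 (hs j).2]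

end Clamp

end Summit.QuantumFields.YangMills.Theorems.N21ThresholdMixtureCommonBoxRescale

end
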